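import Summits.QuantumFields.YangMills.Theorems.NPointIsotropy.Negative.TieLoadBearing
import Summits.QuantumFields.YangMills.Theorems.CurvatureBoostCovariance.Negative.OnAllTestsFalse

/-!
# `SoftKernelBoostCovariance` — negative-side support I: the crux unbundled; the lattice TIE AT ORDER 4 is the
load-bearing clause (even with the planar cone AND the soft kernel); the parent's model-blind core is false

Support file for crux `stmt-QuantumFields-14999` (`MirrorModularBoosts.SoftKernelBoostCovariance`, the engine
below dimension five; refuter, cdisprove), extracted from the standing disprover's work file
`Cruxes/SoftKernelBoostCovariance/Disproof.lean`.  Tree objects only; nothing is posited.  The unbundling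
predicates `W1`, `Tie`, `OSPackage`, `Translations`, `Hypercubic`, `Gaps`, `EightFrameRP`, `PlanarCone`,
`PlanarInvariant(OnAllTests)`, `ModelBlind` are the LANDED ones of the parent crux
`CurvatureBoostCovariance.Negative`; the junk family `junk` (`𝔖₀ = 1`, `𝔖₄ = J`, `𝔖ₙ = 0` otherwise) and its OS
clauses are the LANDED ones of `NPointIsotropy.Negative`.

* `SoftKernel S₁` — the kernel triple of the crux (verbatim the conclusion of `CurvatureKernelBound` at `S₁`);
  `softKernelBoostCovariance_iff` (definitional): the crux is
  `∀ G …, W1 r sch S₁ → EightFrameRP S₁ → PlanarCone S₁ → SoftKernel S₁ → PlanarInvariant S₁`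
  (the parent crux `CurvatureBoostCovariance` implies this one — one hypothesis more —, so the parent's
  tie-pinning analysis `Negative.Unbundled.tie_unique` and its `β ≡ 0` / `c ≡ 0` collapse apply verbatim).
* `planarCone_junk` (NEW): the junk family HAS the planar spectral cone — `Φ ≡ conj F(∅) G(∅)` in degree `0+0`
  and `Φ ≡ 0` otherwise, because `J` kills every `θF* ⊗ G_{t e₀ + b e₁}` with `F, G` time-ordered, `t > 0`.
  With `softKernel_junk` (`K = 0`, `C = 0`, `η = 1`) the junk family therefore meets EVERY clause of the crux
  about `S₁` alone.
* `SoftKernelBoostCovarianceWithoutTieAt4` — the crux with the Wilson-convergence clause (the TIE) required at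
  every order `n ≠ 4` but NOT at `n = 4`; the uniform lattice gap, the continuum gap, the eight frames, the cone
  and the soft kernel all kept verbatim.  `not_softKernelBoostCovarianceWithoutTieAt4` REFUTES it (`G = SU(2)`,
  fundamental representation, zero scheme, `S₁ = junk`): ANY PROOF of the crux must use the convergence of the
  lattice FOUR-point functions of `tr F²` at order 4 itself — not only the gaps, the cone, `K`, or the tie at
  orders `≤ 3`.  Corollaries `not_softKernelBoostCovarianceWithoutTie`, `not_softKernelModelBlind`, and
* `not_modelBlind : ¬ CurvatureBoostCovariance.Negative.ModelBlind` — the parent's documented NEAR-MISS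
  (`Cruxes/CurvatureBoostCovariance/Disproof.lean` §1b, left `sorry` with the Gaussian zoo as paper witness) is
  now a theorem: the model-blind core of the parent engine is false IN LEAN, by junk (no Gaussian needed).
* `not_softKernelBoostCovarianceOnAllTests`: the natural strengthening (conclusion on all of `𝓢`, not only `⁰𝒮`)
  is false for this crux too (`S♯` of the parent's support file III has `𝔖₂ = 0`, hence the soft kernel `K = 0`).
* `hypotheses_vac_soft`: NON-VACUITY — for every `G`, `r` the zero scheme and the vacuum family satisfy `W₁`,
  the eight frames, the cone AND the soft kernel (and the conclusion).

MORAL for the line (Sketch / transverse-slack-heat-sandwich): of the six registered stubs only `stub_tieRegularity`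
and `stub_sandwichBound` consume the tie; the junk family passes every MODEL-BLIND stub vacuously (all its OS field
vectors of positive degree are `0`), so the anisotropy of `junk 4` is caught by `NPointRegular` (Step 0) alone —
exactly as in the parent line.
-/

noncomputable section

-- Mathlib's `SimplexCategory` instance `Fintype (Fin (x.len + 1))` matches `Fintype (Fin 4)` and makes concrete
-- `Fin 4` instance paths diverge between elaborations (tree-known workaround, cf. the imported support files).
attribute [-instance] SimplexCategory.instFintypeToTypeOrderHomFinHAddNatLenOfNat

namespace Summit.QuantumFields.YangMills.Theorems.SoftKernelBoostCovariance.Negative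

open scoped BigOperators SchwartzMap ComplexConjugate
open MeasureTheory Filter Topology Complex
open Literature.MathematicalPhysics.QuantumLattice Literature.MathematicalPhysics.AQFT
  Literature.MathematicalPhysics.QuantumFieldTheory
open Summit.QuantumFields.YangMills.Theorems.NPointIsotropy.Negative
open Summit.QuantumFields.YangMills.Theorems.CurvatureBoostCovariance.Negative
  (OSPackage Translations Hypercubic EightFrameRP PlanarCone PlanarInvariant PlanarInvariantOnAllTests Tie Gaps W1
    ModelBlind vac vac_of_ne_zero conj_mul_eq_fin0 hypotheses_vac sharp sharp_of_ne sharp_three_apply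
    hypotheses_sharp halfTurn det_halfTurn halfTurn_single_two halfTurn_single_three halfTurn_symm_e1
    exists_bump_three)

/-! ## §0 The kernel triple; the crux unbundled -/

/-- **The soft two-point kernel** (verbatim the conclusion of `MirrorModularBoosts.CurvatureKernelBound` at `S₁`,
the extra hypothesis of this crux over its parent): `𝔖₂|⁰𝒮` is integration against a real kernel `K(x₀ − x₁)`,
continuous off `0`, with `|K x| ≤ C (1 + ‖x‖^(η-10))` for some `η > 0`. -/
def SoftKernel (S₁ : SchwingerFamily E4) : Prop :=
  ∃ (K : E4 → ℝ) (C η : ℝ), 0 < η ∧ ContinuousOn K {x : E4 | x ≠ 0} ∧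
    (∀ x : E4, x ≠ 0 → |K x| ≤ C * (1 + ‖x‖ ^ (η - 10))) ∧
    ∀ F : 𝓢((Fin 2 → E4), ℂ), IsOffDiagonal F →
      MeasureTheory.Integrable (fun x : Fin 2 → E4 => (K (x 0 - x 1) : ℂ) * F x) ∧
        S₁ 2 F = ∫ x : Fin 2 → E4, (K (x 0 - x 1) : ℂ) * F x

/-- **§0a. The crux, unbundled** (definitional): for every compact simple `G` (Borel σ-algebra),
`W1 r sch S₁ → EightFrameRP S₁ → PlanarCone S₁ → SoftKernel S₁ → PlanarInvariant S₁`. -/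
theorem softKernelBoostCovariance_iff :
    Summit.QuantumFields.YangMills.Theses.MirrorModularBoosts.SoftKernelBoostCovariance ↔
      ∀ (G : Type) [Group G] [TopologicalSpace G] [IsTopologicalGroup G] [CompactSpace G],
        IsCompactSimpleLieGroup G →
        letI : MeasurableSpace G := borel G
        haveI : BorelSpace G := ⟨rfl⟩
        ∀ (r : LatticeRep G) (sch : SpeciesScheme (YMSpecies G)) (S₁ : SchwingerFamily E4),
          W1 r sch S₁ → EightFrameRP S₁ → PlanarCone S₁ → SoftKernel S₁ → PlanarInvariant S₁ :=
  Iff.rfl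

/-- A family vanishing on `⁰𝒮` in degree `2` has the soft kernel `K = 0` (`C = 0`, `η = 1`). -/
theorem softKernel_of_two_eq_zero (S₁ : SchwingerFamily E4)
    (h : ∀ F : 𝓢((Fin 2 → E4), ℂ), IsOffDiagonal F → S₁ 2 F = 0) : SoftKernel S₁ :=
  ⟨fun _ => 0, 0, 1, one_pos, continuousOn_const, fun x _ => by simp, fun F hF => ⟨by simp, by simp [h F hF]⟩⟩

/-- The vacuum family has the soft kernel `K = 0`. -/
theorem softKernel_vac : SoftKernel vac :=
  softKernel_of_two_eq_zero _ fun F _ => by rw [vac_of_ne_zero two_ne_zero]; rfl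

/-- The germ family `S♯` of the parent's support file III has the soft kernel `K = 0`. -/
theorem softKernel_sharp : SoftKernel sharp :=
  softKernel_of_two_eq_zero _ fun F _ => by rw [sharp_of_ne (by decide), vac_of_ne_zero two_ne_zero]; rfl

/-- The junk family has the soft kernel `K = 0` (`𝔖₂ = 0`). -/
theorem softKernel_junk : SoftKernel junk :=
  softKernel_of_two_eq_zero _ fun F _ => by
    rw [junk_of_ne (show (2 : ℕ) ≠ 0 by decide) (show (2 : ℕ) ≠ 4 by decide)]; rfl

/-! ## §1 The junk family has the planar spectral cone -/

/-- The time component of `t e₀ + b e₁` is `t`. -/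
theorem planarShift_apply_zero (t b : ℝ) :
    (t • EuclideanSpace.single (0 : Fin 4) (1 : ℝ) + b • EuclideanSpace.single (1 : Fin 4) (1 : ℝ) : E4) 0 = t := by
  simp

/-- **§1. `PlanarCone junk`.**  Every hypothesis-side evaluation of the cone is `junk (n+m) (θF* ⊗ G_{t e₀ + b e₁})`
with `F, G` time-ordered and `t > 0`, a configuration with pairwise distinct times, killed by `J`
(`junk_append_eq_zero`); so `Φ ≡ 0` works in positive total degree and the constant `conj F(∅) G(∅)` in degree
`0 + 0` (where the Cauchy–Schwarz bound is an equality). -/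
theorem planarCone_junk : PlanarCone junk := by
  intro n m F G hF hG
  by_cases hnm : n + m = 0
  · obtain ⟨rfl, rfl⟩ : n = 0 ∧ m = 0 := by omega
    haveI hE : IsEmpty (Fin (0 + 0)) := (inferInstance : IsEmpty (Fin 0))
    refine ⟨fun _ => conj (F 0) * G 0, differentiableOn_const _, fun t b _ H hH => ?_,
      fun w _ HF HG hHF hHG => ?_⟩
    · rw [junk_apply_of_eq_zero rfl H 0, hH, osAdjoint_apply, translateMulti_apply]
      exact conj_mul_eq_fin0 F G _ _ _ _
    · have h1 : junk (0 + 0) HF = conj (F 0) * F 0 := by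
        rw [junk_apply_of_eq_zero rfl HF 0, hHF, osAdjoint_apply]
        exact conj_mul_eq_fin0 F F _ _ _ _
      have h2 : junk (0 + 0) HG = conj (G 0) * G 0 := by
        rw [junk_apply_of_eq_zero rfl HG 0, hHG, osAdjoint_apply]
        exact conj_mul_eq_fin0 G G _ _ _ _
      rw [h1, h2, norm_mul, norm_mul, norm_mul, Complex.norm_conj, Complex.norm_conj]
      exact le_of_eq (by ring)
  · refine ⟨fun _ => 0, differentiableOn_const _, fun t b ht H hH => ?_, fun w _ HF HG _ _ => ?_⟩
    · have hG' : TimeSep (translateMulti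
          (t • EuclideanSpace.single (0 : Fin 4) (1 : ℝ) + b • EuclideanSpace.single (1 : Fin 4) (1 : ℝ)) G) :=
        (timeSep_of_isTimeOrdered hG).translate _ (by rw [planarShift_apply_zero]; exact ht.le)
      rw [junk_append_eq_zero hnm (timeSep_of_isTimeOrdered hF) hG' hH]
    · simp only [norm_zero, ne_eq, OfNat.ofNat_ne_zero, not_false_eq_true, zero_pow]
      positivity

/-! ## §2 Non-vacuity of the whole hypothesis set -/

section NonVacuity

variable {G : Type} [Group G] [TopologicalSpace G] [IsTopologicalGroup G] [CompactSpace G]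
  [MeasurableSpace G] [BorelSpace G]

/-- **§2. NON-VACUITY.**  For EVERY compact group `G` and EVERY lattice representation `r`, the zero scheme and the
vacuum family satisfy `W₁`, the eight-frame RP, the planar cone AND the soft kernel (`K = 0`), and the conclusion:
the hypotheses of the crux are jointly satisfiable and no refutation can come from the kernel clause alone. -/
theorem hypotheses_vac_soft (r : LatticeRep G) :
    W1 r (SpeciesScheme.zero _) vac ∧ EightFrameRP vac ∧ PlanarCone vac ∧ SoftKernel vac ∧ PlanarInvariant vac := by
  obtain ⟨hW, h8, hC, hP⟩ := hypotheses_vac r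
  exact ⟨hW, h8, hC, softKernel_vac, hP⟩

end NonVacuity

/-! ## §3 Weakenings of the hypothesis set -/

/-- **The crux without the tie AT ORDER 4**: the Wilson-convergence clause is required for every `n ≠ 0` with
`n ≠ 4`; every other clause of `W₁` (OS package, translations, proper hypercubic invariance, continuum gap AND the
uniform lattice gap `HasLatticeMassGap r sch Δ`), the eight frames, the planar cone and the soft kernel are kept
verbatim.  Refuted below. -/
def SoftKernelBoostCovarianceWithoutTieAt4 : Prop :=
  ∀ (G : Type) [Group G] [TopologicalSpace G] [IsTopologicalGroup G] [CompactSpace G],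
    IsCompactSimpleLieGroup G →
    letI : MeasurableSpace G := borel G
    haveI : BorelSpace G := ⟨rfl⟩
    ∀ (r : LatticeRep G) (sch : SpeciesScheme (YMSpecies G)) (S₁ : SchwingerFamily E4),
      ((∀ (n : ℕ), n ≠ 0 → n ≠ 4 → ∀ (f : Fin n → 𝓢(E4, ℝ)) (F : 𝓢((Fin n → E4), ℂ)),
          IsTensorOf F (fun i => ofRealTest (f i)) → IsOffDiagonal F →
            Tendsto (fun k : ℕ => ((latticeSchwinger r.ρ sch (fun s => s.F) k n
              (fun _ => r.curvature) f : ℝ) : ℂ)) atTop (𝓝 (S₁ n F))) ∧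
        OSPackage S₁ ∧ Translations S₁ ∧ Hypercubic S₁ ∧ Gaps r sch S₁) →
      EightFrameRP S₁ → PlanarCone S₁ → SoftKernel S₁ → PlanarInvariant S₁

/-- **The crux without the tie** (all orders dropped; both gaps, in particular `HasLatticeMassGap`, kept). -/
def SoftKernelBoostCovarianceWithoutTie : Prop :=
  ∀ (G : Type) [Group G] [TopologicalSpace G] [IsTopologicalGroup G] [CompactSpace G],
    IsCompactSimpleLieGroup G →
    letI : MeasurableSpace G := borel G
    haveI : BorelSpace G := ⟨rfl⟩
    ∀ (r : LatticeRep G) (sch : SpeciesScheme (YMSpecies G)) (S₁ : SchwingerFamily E4),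
      (OSPackage S₁ ∧ Translations S₁ ∧ Hypercubic S₁ ∧ Gaps r sch S₁) →
      EightFrameRP S₁ → PlanarCone S₁ → SoftKernel S₁ → PlanarInvariant S₁

/-- **The model-blind core of THIS crux**: every clause about `S₁` alone (the parent's `ModelBlind` plus the soft
kernel); no gauge group, scheme, tie or lattice gap. -/
def SoftKernelModelBlind : Prop :=
  ∀ (S₁ : SchwingerFamily E4), OSPackage S₁ → Translations S₁ → Hypercubic S₁ →
    (∃ Δ : ℝ, 0 < Δ ∧ S₁.toLabelled.HasMassGap Δ) → EightFrameRP S₁ → PlanarCone S₁ → SoftKernel S₁ →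
      PlanarInvariant S₁

/-- **The crux without the uniform lattice gap** (`HasLatticeMassGap` dropped; tie, continuum gap, frames, cone,
kernel kept).  NOT refuted here — a tied family is a Wilson scaling limit of the `tr F²` strings on `⁰𝒮`-tensors and
no certifiable scheme ties an anisotropic one; recorded so that provers know the lattice gap is possibly
unnecessary (it enters no stub of the picked line). -/
def SoftKernelBoostCovarianceWithoutLatticeGap : Prop :=
  ∀ (G : Type) [Group G] [TopologicalSpace G] [IsTopologicalGroup G] [CompactSpace G],
    IsCompactSimpleLieGroup G →
    letI : MeasurableSpace G := borel G
    haveI : BorelSpace G := ⟨rfl⟩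
    ∀ (r : LatticeRep G) (sch : SpeciesScheme (YMSpecies G)) (S₁ : SchwingerFamily E4),
      (Tie r sch S₁ ∧ OSPackage S₁ ∧ Translations S₁ ∧ Hypercubic S₁ ∧
          ∃ Δ : ℝ, 0 < Δ ∧ S₁.toLabelled.HasMassGap Δ) →
      EightFrameRP S₁ → PlanarCone S₁ → SoftKernel S₁ → PlanarInvariant S₁

/-- `WithoutTieAt4` implies the crux (forget the tie at order 4). -/
theorem softKernelBoostCovariance_of_withoutTieAt4 (h : SoftKernelBoostCovarianceWithoutTieAt4) :
    Summit.QuantumFields.YangMills.Theses.MirrorModularBoosts.SoftKernelBoostCovariance := by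
  rw [softKernelBoostCovariance_iff]
  intro G _ _ _ _ hG r sch S₁ hW h8 hC hK
  exact h G hG r sch S₁ ⟨fun n hn _ f F hF hF' => hW.1 n hn f F hF hF', hW.2⟩ h8 hC hK

/-- `WithoutTie` implies `WithoutTieAt4` (forget the remaining orders of the tie). -/
theorem withoutTieAt4_of_withoutTie (h : SoftKernelBoostCovarianceWithoutTie) :
    SoftKernelBoostCovarianceWithoutTieAt4 := by
  intro G _ _ _ _ hG r sch S₁ hW h8 hC hK
  exact h G hG r sch S₁ hW.2 h8 hC hK

/-- The model-blind core implies `WithoutTie` (forget `G`, `r`, `sch` and the lattice gap). -/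
theorem withoutTie_of_softKernelModelBlind (h : SoftKernelModelBlind) : SoftKernelBoostCovarianceWithoutTie := by
  intro G _ _ _ _ hG r sch S₁ hW h8 hC hK
  obtain ⟨hOS, htr, hhyp, Δ, hΔ, hgap, -⟩ := hW
  exact h S₁ hOS htr hhyp ⟨Δ, hΔ, hgap⟩ h8 hC hK

/-- The PARENT's model-blind core implies the child's (forget the soft kernel). -/
theorem softKernelModelBlind_of_modelBlind (h : ModelBlind) : SoftKernelModelBlind :=
  fun S₁ hOS htr hhyp hgap h8 hC _ => h S₁ hOS htr hhyp hgap h8 hC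

/-- `WithoutLatticeGap` implies the crux (forget `HasLatticeMassGap`). -/
theorem softKernelBoostCovariance_of_withoutLatticeGap (h : SoftKernelBoostCovarianceWithoutLatticeGap) :
    Summit.QuantumFields.YangMills.Theses.MirrorModularBoosts.SoftKernelBoostCovariance := by
  rw [softKernelBoostCovariance_iff]
  intro G _ _ _ _ hG r sch S₁ hW h8 hC hK
  obtain ⟨htie, hOS, htr, hhyp, Δ, hΔ, hgap, -⟩ := hW
  exact h G hG r sch S₁ ⟨htie, hOS, htr, hhyp, Δ, hΔ, hgap⟩ h8 hC hK

/-! ## §4 The tie at order 4 is load-bearing; the model-blind cores (child AND parent) are false -/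

section JunkLattice

variable {G : Type} [Group G] [TopologicalSpace G] [IsTopologicalGroup G] [CompactSpace G]
  [MeasurableSpace G] [BorelSpace G]

/-- **The junk family satisfies every hypothesis of `WithoutTieAt4`** over any `G`, any `r` and the zero scheme:
the tie at all orders `≠ 4`, the OS package, translations, proper hypercubic invariance, both gaps with `Δ = 1`
(`HasLatticeMassGap` by `β ≡ 0`), RP in the eight frames, the planar cone, and the soft kernel `K = 0`. -/
theorem junk_hypotheses_softWithoutTieAt4 (r : LatticeRep G) :
    ((∀ (n : ℕ), n ≠ 0 → n ≠ 4 → ∀ (f : Fin n → 𝓢(E4, ℝ)) (F : 𝓢((Fin n → E4), ℂ)),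
        IsTensorOf F (fun i => ofRealTest (f i)) → IsOffDiagonal F →
          Tendsto (fun k : ℕ => ((latticeSchwinger r.ρ (SpeciesScheme.zero (YMSpecies G)) (fun s => s.F) k n
            (fun _ => r.curvature) f : ℝ) : ℂ)) atTop (𝓝 (junk n F))) ∧
      OSPackage junk ∧ Translations junk ∧ Hypercubic junk ∧ Gaps r (SpeciesScheme.zero (YMSpecies G)) junk) ∧
    EightFrameRP junk ∧ PlanarCone junk ∧ SoftKernel junk := by
  obtain ⟨hW, h8, -⟩ := junk_hypotheses_withoutTieAt4 r
  exact ⟨hW, h8, planarCone_junk, softKernel_junk⟩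

end JunkLattice

/-- **Theorem (the tie at order 4 is load-bearing, EVEN WITH THE CONE AND THE SOFT KERNEL).**
`SoftKernelBoostCovarianceWithoutTieAt4` is false: `G = SU(2)`, the fundamental representation, the zero scheme,
`S₁ = junk`; every hypothesis holds (`junk_hypotheses_softWithoutTieAt4`) and `𝔖₄(R₀ · F₀) = 0 ≠ 𝔖₄(F₀)`
(`not_conclusionOf_junk`).  Hence any proof of the crux must use the convergence of the lattice FOUR-point functions
of the curvature at order 4 itself: the eight frames, the cone, the continuum and lattice gaps, the soft two-point
kernel and the tie at orders `≠ 4` together do not give planar invariance of `𝔖₄`. -/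
theorem not_softKernelBoostCovarianceWithoutTieAt4 : ¬ SoftKernelBoostCovarianceWithoutTieAt4 := by
  intro h
  have hG : IsCompactSimpleLieGroup (Matrix.specialUnitaryGroup (Fin 2) ℂ) :=
    isCompactSimpleLieGroup_specialUnitaryGroup isSimpleCompactGroup_specialUnitaryGroup_holds le_rfl
  letI : MeasurableSpace (Matrix.specialUnitaryGroup (Fin 2) ℂ) := borel _
  haveI : BorelSpace (Matrix.specialUnitaryGroup (Fin 2) ℂ) := ⟨rfl⟩
  let r : LatticeRep (Matrix.specialUnitaryGroup (Fin 2) ℂ) :=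
    ⟨2, fundamentalRep (Fin 2), continuous_fundamentalRep _, fundamentalRep_injective _,
      fundamentalRep_mem_unitaryGroup⟩
  obtain ⟨hW, h8, hC, hK⟩ := junk_hypotheses_softWithoutTieAt4 r
  exact not_conclusionOf_junk
    (h (Matrix.specialUnitaryGroup (Fin 2) ℂ) hG r (SpeciesScheme.zero _) junk hW h8 hC hK)

/-- **Corollary (the whole tie is load-bearing; the lattice gap does not rescue the model-blind form).** -/
theorem not_softKernelBoostCovarianceWithoutTie : ¬ SoftKernelBoostCovarianceWithoutTie :=
  fun h => not_softKernelBoostCovarianceWithoutTieAt4 (withoutTieAt4_of_withoutTie h)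

/-- **Corollary (the model-blind core of THIS crux is false).**  The junk family is a one-species family on `ℝ⁴`
with E0, E0h, E0', E2, E3, E4, translations, proper hypercubic invariance, mass gap `1`, RP in the eight planar
frames, the planar spectral cone and the soft kernel `K = 0`, whose `𝔖₄` is not planar-rotation invariant on `⁰𝒮`. -/
theorem not_softKernelModelBlind : ¬ SoftKernelModelBlind :=
  fun h => not_softKernelBoostCovarianceWithoutTie (withoutTie_of_softKernelModelBlind h)

/-- **Corollary (the PARENT's near-miss closed): the model-blind core `ModelBlind` of
`MirrorModularBoosts.CurvatureBoostCovariance` is false.**  The parent disprover's work file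
(`Cruxes/CurvatureBoostCovariance/Disproof.lean` §1b, `curvatureBoostCovariance_false_without_hconv`) left this as
its one `sorry`, with the `W(B₄)`-symmetric generalised free field `(1 + ε e₂(p_μ²)²)/(p² + m²)` as paper witness;
the junk family is a Lean witness (singular `𝔖₄` supported on the exceptional set, no Gaussian analysis). -/
theorem not_modelBlind : ¬ ModelBlind :=
  fun h => not_softKernelModelBlind (softKernelModelBlind_of_modelBlind h)

/-! ## §5 The natural strengthening "invariance as equality of functionals on all of `𝓢`" is false -/

/-- The crux with its conclusion stated on ALL test functions (not only on `⁰𝒮`). -/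
def SoftKernelBoostCovarianceOnAllTests : Prop :=
  ∀ (G : Type) [Group G] [TopologicalSpace G] [IsTopologicalGroup G] [CompactSpace G],
    IsCompactSimpleLieGroup G →
    letI : MeasurableSpace G := borel G
    haveI : BorelSpace G := ⟨rfl⟩
    ∀ (r : LatticeRep G) (sch : SpeciesScheme (YMSpecies G)) (S₁ : SchwingerFamily E4),
      W1 r sch S₁ → EightFrameRP S₁ → PlanarCone S₁ → SoftKernel S₁ → PlanarInvariantOnAllTests S₁

/-- `OnAllTests` implies the crux (restrict the conclusion to `⁰𝒮`). -/
theorem softKernelBoostCovariance_of_onAllTests (h : SoftKernelBoostCovarianceOnAllTests) :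
    Summit.QuantumFields.YangMills.Theses.MirrorModularBoosts.SoftKernelBoostCovariance := by
  rw [softKernelBoostCovariance_iff]
  intro G _ _ _ _ hG r sch S₁ hW h8 hC hK R hR h2 h3 n F _
  exact h G hG r sch S₁ hW h8 hC hK R hR h2 h3 n F

/-- **§5. THE NATURAL STRENGTHENING IS FALSE** for this crux as for its parent: `G = SU(2)`, fundamental
representation, zero scheme, `S₁ = S♯` (vacuum + evaluation at `(e₁,e₁,e₁)` in degree 3, soft kernel `K = 0`), the
half-turn of the `(x₀,x₁)`-plane and the bump at `(e₁,e₁,e₁)`.  Never state the invariance as equality of functionals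
on `𝓢`: nothing pins a tied family at coincident points. -/
theorem not_softKernelBoostCovarianceOnAllTests : ¬ SoftKernelBoostCovarianceOnAllTests := by
  intro h
  have hG : IsCompactSimpleLieGroup (Matrix.specialUnitaryGroup (Fin 2) ℂ) :=
    isCompactSimpleLieGroup_specialUnitaryGroup isSimpleCompactGroup_specialUnitaryGroup_holds le_rfl
  letI : MeasurableSpace (Matrix.specialUnitaryGroup (Fin 2) ℂ) := borel _
  haveI : BorelSpace (Matrix.specialUnitaryGroup (Fin 2) ℂ) := ⟨rfl⟩
  let r : LatticeRep (Matrix.specialUnitaryGroup (Fin 2) ℂ) :=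
    ⟨2, fundamentalRep (Fin 2), continuous_fundamentalRep _, fundamentalRep_injective _,
      fundamentalRep_mem_unitaryGroup⟩
  obtain ⟨hW, h8, hC, -⟩ := hypotheses_sharp r
  have key := h (Matrix.specialUnitaryGroup (Fin 2) ℂ) hG r (SpeciesScheme.zero _) sharp hW h8 hC softKernel_sharp
    halfTurn det_halfTurn halfTurn_single_two halfTurn_single_three 3
  obtain ⟨F, hF1, hF0⟩ := exists_bump_three
  have h1 := key F
  rw [sharp_three_apply, sharp_three_apply, linActMulti_apply] at h1
  simp only [halfTurn_symm_e1] at h1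
  rw [hF0, hF1] at h1
  exact zero_ne_one h1

end Summit.QuantumFields.YangMills.Theorems.SoftKernelBoostCovariance.Negative

end
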